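import Summits.BirchSwinnertonDyer.BirchSwinnertonDyer.Theorems.UniversalToricDescentDualPairToolkit
import HarnessLib

/-!
# The cokernel count of a transpose: `#((X_Y ⧸ Θ^∨ X_P) ⧸ (p^m, ω_m)) ≤ #{s ∈ ker Θ | p^m s = 0}`
# (crux ♭T≤ stmt-BirchSwinnertonDyer-23042 `DefectTransportModThreePT`, line `sigmacongruence`, stub TS1′, assembly (1e))

Route `UniversalToricDescent`, lead prover `bsd-wall-utd-p1` g16. THEOREMS ONLY (no definition, no named fact, no `sorry`);
`--supports stmt-BirchSwinnertonDyer-23042`. BSD is not proved by any of this.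

For dual pairs `(X_Y, S_Y, ψ_Y)`, `(X_P, S_P, ψ_P)` (toolkit `isDualPair_id_of_isLocNil` shape: `X = Hom(S, ℚ/ℤ)`, `toDual = id`), an
equivariant `Θ : S_Y → S_P` and its `Λ`-linear transpose `F : X_P → X_Y` (`F x = x ∘ Θ`), with `X_Y` finitely generated: the `Λ`-module
`X_Y ⧸ F(X_P)` is the dual of `ker Θ` (toolkit `range_eq_ker_of_toDual_comp` + `IsDualPair.exists_linearMap_comp_surjective`), so its
diagonal quotient `(X_Y ⧸ F X_P) ⧸ (p^m, ω_m)` has at most `#{s ∈ ker Θ | p^m s = 0}` elements (p646050 for the restricted pair) —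
the hypothesis `hX` of `injective_of_weakLeopoldt_growth` (p645087) in the growth road, reduced to a count inside `ker Θ`.

* `natCard_coker_quotient_le_of_injective` — the statement, with the bound expressed through any injection of
  `{s : ker Θ | p^m s = 0}` into a finite type `T` (on the route: `T = Sel_𝔭^Σ(K_∞, E[p^∞])[p^m]`).

References: [GreenbergLNM1716] §1 p. 60; [GreenbergVatsal2000] §2 Prop. (2.1); Bourbaki, *Algèbre* II §1 no. 9.
-/

-- the Theorems namespace of this sub repeats the summit name by design (D-0017 nested layout)
set_option linter.dupNamespace false

noncomputable section

open scoped Classical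

namespace Summit.BirchSwinnertonDyer.BirchSwinnertonDyer.Theorems.UniversalToricDescentTorsionFreeByCount

open Literature.NumberTheory.EllipticCurves Literature.NumberTheory.EllipticCurves.IwasawaDual
  Summit.BirchSwinnertonDyer.BirchSwinnertonDyer.Theorems.UniversalToricDescentDualPairIdealCount

variable (p : ℕ) [hp : Fact p.Prime]

/-- **Cokernel count of a transpose.** With `X_Y = Hom(S_Y, ℚ/ℤ)`, `X_P = Hom(S_P, ℚ/ℤ)` (dual pairs for `ψ_Y, ψ_P` with `toDual = id`),
`Θ : S_Y → S_P` intertwining `ψ_Y, ψ_P`, `F : X_P → X_Y` `Λ`-linear with `F x = x ∘ Θ`, `X_Y` finitely generated, and an injection of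
`{s ∈ ker Θ | p^m s = 0}` into a finite type `T`: `#((X_Y ⧸ F X_P) ⧸ (p^m, ω_m)) ≤ #T`. [cite: GreenbergLNM1716, §1 p. 60]
[cite: GreenbergVatsal2000, §2 Prop. (2.1)] -/
theorem natCard_coker_quotient_le_of_injective
    {SY : Type} [AddCommGroup SY] {ψY : AddMonoid.End SY} (hLY : IsLocNil p ψY)
    {SP : Type} [AddCommGroup SP] {ψP : AddMonoid.End SP} (hLP : IsLocNil p ψP)
    (Θ : SY →+ SP) (hΘψ : ∀ s, Θ (ψY s) = ψP (Θ s)) :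
    letI := hLY.module (A := AddCircle (1 : ℚ)); letI := hLP.module (A := AddCircle (1 : ℚ))
    ∀ (F : (SP →+ AddCircle (1 : ℚ)) →ₗ[PowerSeries ℤ_[p]] (SY →+ AddCircle (1 : ℚ)))
      (_hF : ∀ (x : SP →+ AddCircle (1 : ℚ)) (s : SY), F x s = x (Θ s))
      [Module.Finite (PowerSeries ℤ_[p]) (SY →+ AddCircle (1 : ℚ))] (m : ℕ) {T : Type} [Finite T]
      (ι : {s : SY // s ∈ Θ.ker ∧ p ^ m • s = 0} → T) (_hι : Function.Injective ι),
      Nat.card (((SY →+ AddCircle (1 : ℚ)) ⧸ LinearMap.range F) ⧸ (Ideal.span {((p : ℕ) : PowerSeries ℤ_[p]) ^ m,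
        ((1 : PowerSeries ℤ_[p]) + PowerSeries.X) ^ (p ^ m) - 1} • ⊤ :
          Submodule (PowerSeries ℤ_[p]) ((SY →+ AddCircle (1 : ℚ)) ⧸ LinearMap.range F))) ≤ Nat.card T := by
  letI instY := hLY.module (A := AddCircle (1 : ℚ))
  letI instP := hLP.module (A := AddCircle (1 : ℚ))
  intro F hF _ m T _ ι hι
  have hdY := isDualPair_id_of_isLocNil p hLY
  have hdP := isDualPair_id_of_isLocNil p hLP
  -- the restricted pair on `ker Θ`
  have hkerstab : ∀ s : Θ.ker, ψY (s : SY) ∈ Θ.ker := fun s ↦ by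
    rw [AddMonoidHom.mem_ker, hΘψ, (AddMonoidHom.mem_ker).mp s.2, map_zero]
  let ψK : AddMonoid.End Θ.ker := (ψY.comp Θ.ker.subtype).codRestrict Θ.ker fun s ↦ hkerstab s
  have hψK : ∀ s : Θ.ker, ((ψK s : Θ.ker) : SY) = ψY s := fun _ ↦ rfl
  have hψKpow : ∀ (N : ℕ) (s : Θ.ker), (((ψK ^ N) s : Θ.ker) : SY) = (ψY ^ N) s := by
    intro N
    induction N with
    | zero => intro s; rfl
    | succ N ih =>
      intro s
      rw [pow_succ, pow_succ, AddMonoid.End.coe_mul, AddMonoid.End.coe_mul, Function.comp_apply,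
        Function.comp_apply, ih, hψK]
  have hLK : IsLocNil p ψK := by
    refine ⟨fun s ↦ ?_, fun s ↦ ?_⟩
    · obtain ⟨k, hk⟩ := hLY.torsion s
      exact ⟨k, Subtype.ext (by rw [AddSubgroupClass.coe_nsmul, hk]; rfl)⟩
    · obtain ⟨N, hN⟩ := hLY.nil s
      exact ⟨N, Subtype.ext (by rw [hψKpow, hN]; rfl)⟩
  letI instK : Module (PowerSeries ℤ_[p]) (Θ.ker →+ AddCircle (1 : ℚ)) := hLK.module
  have hdK := isDualPair_id_of_isLocNil p hLK
  obtain ⟨R, hRsurj, hR⟩ := hdY.exists_linearMap_comp_surjective hdK Θ.ker.subtype (fun s ↦ hψK s)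
    Subtype.val_injective
  have hrange : LinearMap.range F = LinearMap.ker R :=
    range_eq_ker_of_toDual_comp p hdY hdP Θ (toDual'' := AddMonoidHom.id _) Function.injective_id F hF R hR
  let eK : ((SY →+ AddCircle (1 : ℚ)) ⧸ LinearMap.range F) ≃ₗ[PowerSeries ℤ_[p]] (Θ.ker →+ AddCircle (1 : ℚ)) :=
    (Submodule.quotEquivOfEq _ _ hrange).trans (R.quotKerEquivOfSurjective hRsurj)
  have hK := natCard_quotient_span_pow_omega_smul hdK m m
  rw [Nat.cast_pow] at hK
  rw [Module.card_quotSMulTop_eq_of_linearEquiv (Ideal.span {((p : ℕ) : PowerSeries ℤ_[p]) ^ m,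
    ((1 : PowerSeries ℤ_[p]) + PowerSeries.X) ^ (p ^ m) - 1}) eK, hK]
  -- inject the counted set into `{s ∈ ker Θ | p^m s = 0}`, then into `T`
  let j : ((DistribSMul.toAddMonoidHom Θ.ker (p ^ m)).ker ⊓ ((1 + ψK) ^ (p ^ m) - 1).ker : AddSubgroup Θ.ker) →
      {s : SY // s ∈ Θ.ker ∧ p ^ m • s = 0} := fun t ↦
    ⟨((t.1 : Θ.ker) : SY), (t.1 : Θ.ker).2, by
      have ht := (AddSubgroup.mem_inf.mp t.2).1
      rw [AddMonoidHom.mem_ker, DistribSMul.toAddMonoidHom_apply] at ht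
      have ht' := congrArg (fun z : Θ.ker ↦ (z : SY)) ht
      simpa only [AddSubgroupClass.coe_nsmul, ZeroMemClass.coe_zero] using ht'⟩
  have hj : Function.Injective j := fun t₁ t₂ h ↦
    Subtype.ext (Subtype.ext (congrArg (fun z : {s : SY // s ∈ Θ.ker ∧ p ^ m • s = 0} ↦ (z : SY)) h))
  exact Nat.card_le_card_of_injective (ι ∘ j) (hι.comp hj)

end Summit.BirchSwinnertonDyer.BirchSwinnertonDyer.Theorems.UniversalToricDescentTorsionFreeByCount

end
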